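import Literature.Analysis.FluidPDE.AxisymmetricEuler
import Literature.Analysis.FluidPDE.IsometryInvariance
import Literature.Analysis.FluidPDE.EnergyUniqueness
import HarnessLib

/-!
# Propagation of axisymmetry — proof of `IsClassicalNSSolutionOn.isAxisymmetric_of_data`

Trunk: FluidKinetic (topic `Literature/Analysis/FluidPDE`).

`Literature.Analysis.FluidPDE.AxisymmetricEuler` records, as the named fact
`Literature.Analysis.FluidPDE.IsClassicalNSSolutionOn.isAxisymmetric_of_data`, that a classical Navier–Stokes
(`0 < ν`) or Euler (`ν = 0`) solution `(u, p)` of `Literature.Fluid.IsClassicalNSSolutionOn (Ico 0 T) ν f`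
on `ℝ³ × [0, T)` with uniform Schwartz-type spatial decay (`Literature.Analysis.FluidPDE.HasUniformRapidDecayOn`),
axisymmetric forcing `f t` (`t ∈ [0, T)`) and axisymmetric initial velocity `u 0` is axisymmetric
at every `t ∈ [0, T)`. Axisymmetry is the notion of Koch–Nadirashvili–Seregin–Šverák 2009, §1
(arXiv p. 9): "a field `u` is axi-symmetric if `u(Rx) = Ru(x)` for every rotation `R`" about the
`x₃`-axis (`Literature.Analysis.FluidPDE.IsAxisymmetric`, rotations `Literature.Fluid.rotZ θ`); the propagation statement
is folklore there and is printed in Majda–Bertozzi, §2.3.3, (2.52)–(2.53): "then the solution to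
the Navier–Stokes equation will remain axisymmetric".

This file discharges the fact (`Literature.Analysis.FluidPDE.IsClassicalNSSolutionOn.isAxisymmetric_of_data_holds`)
by the argument its docstring describes, assembled from two proved ingredients:

* rotation covariance of the equations (`IsometryInvariance`: for a linear isometry
  `R : E ≃ₗᵢ[ℝ] E`, `(t, x) ↦ R u(t, R⁻¹ x)`, `p(t, R⁻¹ x)` is a classical solution with force
  `R f(t, R⁻¹ x)`, and uniform rapid decay is preserved; Majda–Bertozzi, §1.2, Prop. 1.1 (iii));
* uniqueness of decaying classical solutions (`EnergyUniqueness`,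
  `IsClassicalNSSolutionOn.unique`: Majda–Bertozzi, §3.1.1, Cor. 3.1 of the basic energy
  estimate Prop. 3.1, printed p. 88 — the fact's docstring calls this "Prop. 3.9"; the
  uniqueness result of the book is Cor. 3.1).

For the rotation `R = R_θ` (a linear isometry by `norm_rotZ`, with inverse `R_{−θ}` by
`rotZ_add`, `rotZ_zero`) the rotated solution has force `R f(t, R⁻¹x) = f(t, x)` and datum
`R u(0, R⁻¹x) = u(0, x)` by the assumed axisymmetry, so uniqueness gives `R u(t, R⁻¹ y) = u(t, y)`
on `[0, T)`; put `y = R x`. The statement was found faithful as vendored (not mis-stated; only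
the docstring's internal reference "Prop. 3.9" should read "Cor. 3.1").

## References

* G. Koch, N. Nadirashvili, G. Seregin, V. Šverák, *Liouville theorems for the Navier–Stokes
  equations and applications*, Acta Math. 203 (2009), 83–105, §1 (definition of axi-symmetric
  fields, arXiv:0709.3599 p. 9). [KNSS2009]
* A. J. Majda, A. L. Bertozzi, *Vorticity and Incompressible Flow*, CUP (2002), §1.2 Prop. 1.1
  (iii) (rotation symmetry), §2.3.3 (2.52)–(2.53) (axisymmetry is preserved), §3.1.1 Prop. 3.1 /
  Cor. 3.1, printed pp. 87–88 (basic energy estimate, uniqueness). [MajdaBertozziCUP2002]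
-/

noncomputable section

open MeasureTheory Set Function Filter Topology

namespace Literature.Analysis.FluidPDE

/-- Local notation for physical space `ℝ³ = EuclideanSpace ℝ (Fin 3)`. -/
local notation "ℝ³" => EuclideanSpace ℝ (Fin 3)

/-- **Discharge** of `IsClassicalNSSolutionOn.isAxisymmetric_of_data`: a classical
Navier–Stokes (`0 < ν`) or Euler (`ν = 0`) solution on `ℝ³ × [0, T)` with uniform Schwartz-type
spatial decay, axisymmetric forcing and axisymmetric initial velocity stays axisymmetric.
Sources: KNSS 2009, §1 (arXiv:0709.3599, p. 9): "a field `u` is axi-symmetric if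
`u(Rx) = Ru(x)` for every rotation `R`" about the `x₃`-axis — the definition `IsAxisymmetric`;
the propagation statement itself is folklore there and is printed in Majda–Bertozzi, §2.3.3,
(2.52)–(2.53) ("the solution to the Navier–Stokes equation will remain axisymmetric"). Proof as
in the docstring of the fact: for the rotation `R = R_θ` (a linear isometry equivalence by
`norm_rotZ`, `rotZ_add`, `rotZ_zero`),
`(t, x) ↦ R u(t, R⁻¹x)`, `p(t, R⁻¹x)` is a classical solution with force
`R f(t, R⁻¹ x) = f(t, x)` and the same decay
(`IsClassicalNSSolutionOn.conj_linearIsometryEquiv`,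
`HasUniformRapidDecayOn.conj_linearIsometryEquiv`; Majda–Bertozzi, Prop. 1.1 (iii)), with the
same initial datum since `u 0` is axisymmetric; by uniqueness of decaying classical solutions
(`IsClassicalNSSolutionOn.unique`, Majda–Bertozzi, §3.1.1, Cor. 3.1 — the fact's docstring's
"Prop. 3.9" is this Cor. 3.1) the two solutions agree on `[0, T)`, i.e.
`R u(t, R⁻¹ y) = u(t, y)`; put `y = R x`. [cite: KNSS2009, §1 (definition of axi-symmetry, arXiv p. 9); MajdaBertozziCUP2002, §2.3.3 (2.52)–(2.53) and §3.1.1 Cor. 3.1, p. 88] -/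
theorem IsClassicalNSSolutionOn.isAxisymmetric_of_data_holds :
    IsClassicalNSSolutionOn.isAxisymmetric_of_data := by
  intro T ν f u p hν h hdec hf h0 t ht θ x
  have hS : UniqueDiffOn ℝ (Ico 0 T) := uniqueDiffOn_Ico 0 T
  -- the rotation `R_θ` as a linear isometry of `ℝ³`
  let Rₗ : ℝ³ ≃ₗ[ℝ] ℝ³ :=
    { toFun := rotZ θ
      invFun := rotZ (-θ)
      map_add' := fun y z => by
        ext i; fin_cases i <;> simp <;> ring
      map_smul' := fun c y => by
        ext i; fin_cases i <;> simp <;> ring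
      left_inv := fun y => by
        show rotZ (-θ) (rotZ θ y) = y
        rw [← rotZ_add, neg_add_cancel, rotZ_zero]
      right_inv := fun y => by
        show rotZ θ (rotZ (-θ) y) = y
        rw [← rotZ_add, add_neg_cancel, rotZ_zero] }
  let R : ℝ³ ≃ₗᵢ[ℝ] ℝ³ := ⟨Rₗ, norm_rotZ θ⟩
  have hR : ∀ y, R y = rotZ θ y := fun _ => rfl
  -- the rotated solution has the same force, decay and initial datum
  have hv : IsClassicalNSSolutionOn (Ico 0 T) ν f (fun s y => R (u s (R.symm y)))
      (fun s y => p s (R.symm y)) := by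
    refine (h.conj_linearIsometryEquiv R hS).congr_force fun s hs y => ?_
    have e := hf s hs θ (R.symm y)
    rw [← hR, R.apply_symm_apply] at e
    exact e.symm
  have hvdec : HasUniformRapidDecayOn (Ico 0 T) (fun s y => R (u s (R.symm y))) :=
    hdec.conj_linearIsometryEquiv R hS
  have hv0 : (fun s y => R (u s (R.symm y))) 0 = u 0 := by
    funext y
    have e := h0 θ (R.symm y)
    rw [← hR, ← hR, R.apply_symm_apply] at e
    exact e.symm
  -- uniqueness of decaying classical solutions
  have huniq := IsClassicalNSSolutionOn.unique hν hv h hvdec hdec hv0 ht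
  have e := congrFun huniq (R x)
  simp only [R.symm_apply_apply] at e
  rw [hR, hR] at e
  exact e.symm

end Literature.Analysis.FluidPDE
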